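import Literature.AlgebraicGeometry.HodgeTheory.FermatInductiveClaims
import Literature.AlgebraicGeometry.HodgeTheory.FermatShiodaCondition
import HarnessLib

/-!
# Sketch — crux ideas for `HodgeFermatVarieties` (stmt-HodgeConjecture-1334), ideator 1, round 1

First-lemma signatures of the three idea cards (they need not be proved here; they must elaborate).
All statements are over the tree's real carriers `FermatCharacter.Claim m r α`
(`fermatEigenspace m α (2r) ≤ algebraicClasses (fermatHypersurface (2r) m) r`),
`FermatCharacter.IsHodge`, `FermatCharacter.IsHodgeMultiset`.
-/

open Finset

namespace Summit.HodgeConjecture.HodgeConjecture.Cruxes.HodgeFermatVarieties.IdeatorOne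

open Literature.AlgebraicGeometry.HodgeTheory

/-! ## Card A — general cancellation and lattice saturation -/

/-- **General cancellation** (Card A, first lemma). For characters `α` of `X²ʳₘ` (all entries
non-zero) and a HODGE character `τ` of `X²ᵗₘ` whose eigenline is algebraic, algebraicity of the
juxtaposed eigenline `V(α∗τ)` on `X^{2(r+t+1)}ₘ` forces algebraicity of `V(α)`.
Aoki 1987 Thm 1-4 (ii) is the case `τ` paired. Proof idea: transpose of Ran's ruled-join
correspondence (Ran 1980 §4, Prop. 4.6, Cor. 4.7) slant an algebraic cycle `Y` with `ω_{-τ}(Y) ≠ 0`. -/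
def GeneralCancellation : Prop :=
  ∀ (m r t : ℕ) [NeZero m] (α : Fin (2 * r + 2) → ZMod m) (τ : Fin (2 * t + 2) → ZMod m)
    (γ : Fin (2 * (r + t + 1) + 2) → ZMod m),
    (∀ i, α i ≠ 0) → FermatCharacter.IsHodge τ →
    univ.val.map γ = univ.val.map α + univ.val.map τ →
    FermatCharacter.Claim m t τ → FermatCharacter.Claim m (r + t + 1) γ →
      FermatCharacter.Claim m r α

/-- A multiset of residues as an integer vector (multiplicity function). -/
noncomputable def toZVec {m : ℕ} (s : Multiset (ZMod m)) : ZMod m →₀ ℤ :=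
  Finsupp.mapRange (fun n : ℕ => (n : ℤ)) (by simp) (Multiset.toFinsupp s)

/-- Aoki's `p`-standard multiset `{a, a+d, …, a+(p-1)d, -pa}`, `d = m/p`. -/
noncomputable def standardMultiset (m p : ℕ) (a : ZMod m) : Multiset (ZMod m) :=
  (Multiset.range p).map (fun j : ℕ => a + (j : ZMod m) * ((m / p : ℕ) : ZMod m)) + {-((p : ZMod m) * a)}

/-- The characters KNOWN to be algebraic, as integer vectors: pairs `{a,-a}` (linear subspaces),
all Hodge multisets of cardinality `4` (Lefschetz `(1,1)` on the Fermat surface), and Aoki's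
`p`-standard elements (`p` odd prime, `d = m/p`, `d/(a,d) > 2`; Aoki 1987 Thm 2-1 plus pull-back). -/
def knownGenerators (m : ℕ) [NeZero m] : Set (ZMod m →₀ ℤ) :=
  {v | ∃ a : ZMod m, a ≠ 0 ∧ v = toZVec ({a, -a} : Multiset (ZMod m))} ∪
  {v | ∃ s : Multiset (ZMod m), FermatCharacter.IsHodgeMultiset s ∧ Multiset.card s = 4 ∧ v = toZVec s} ∪
  {v | ∃ (p : ℕ) (a : ZMod m), p.Prime ∧ p ≠ 2 ∧ p ∣ m ∧ a ≠ 0 ∧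
        2 < (m / p) / Nat.gcd a.val (m / p) ∧ v = toZVec (standardMultiset m p a)}

/-- **Lattice saturation at degree `m`** (Card A, the arithmetic half): every Hodge multiset is an
INTEGER combination of known-algebraic multisets. Census (this card): true for
`m = 39, 66` and every `m ≤ 70` where HC(Xⁿₘ) is in print; index `2` at
`m = 33, 35, 44, 51, 52, 55, 57, 65, 69, 70`. -/
def LatticeSaturation (m : ℕ) [NeZero m] : Prop :=
  ∀ s : Multiset (ZMod m), FermatCharacter.IsHodgeMultiset s →
    toZVec s ∈ Submodule.span ℤ (knownGenerators m)

/-- **Card A, the reduction** (shape of the line): general cancellation + juxtaposition of claims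
+ the known supply + lattice saturation at `m` give `claim(α)` for every Hodge character of every
`X²ʳₘ`. -/
def LatticeReduction : Prop :=
  GeneralCancellation → Aoki1987_claim_juxtaposition →
    ∀ (m : ℕ) [NeZero m], LatticeSaturation m →
      (∀ (t : ℕ) (τ : Fin (2 * t + 2) → ZMod m), FermatCharacter.IsHodge τ →
          toZVec (univ.val.map τ) ∈ knownGenerators m → FermatCharacter.Claim m t τ) →
      ∀ (r : ℕ) (α : Fin (2 * r + 2) → ZMod m), FermatCharacter.IsHodge α →
        FermatCharacter.Claim m r α

/-! ## Card B — odd Fermat varieties: level-one pieces and accidental dualities -/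

/-- `β : Fin (2k+3) → ℤ/m` (a character of the ODD Fermat variety `X^{2k+1}ₘ`) is
**Ran-reachable**: merging two of its entries gives a Hodge multiset of cardinality `2k+2`
(so `β = θ_j(Hodge character of X^{2k}ₘ)` up to permutation, Ran 1980 Prop. 3.13), hence by
Ran's Prop. 3.15 the eigenline `V(β) ⊂ H^{2k+1}` has coniveau `k` once that Hodge character is
algebraic. -/
def RanReachable {m : ℕ} {k : ℕ} (β : Fin (2 * k + 3) → ZMod m) : Prop :=
  ∃ i j : Fin (2 * k + 3), i ≠ j ∧
    FermatCharacter.IsHodgeMultiset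
      (((univ.val.map β).erase (β i)).erase (β j) + {β i + β j})

/-- **Odd gluing lemma** (Card B, first lemma). If `α ∈ 𝔅^{4k+4}ₘ` is Shioda's type-I gluing
`β#γ` of two characters of the odd Fermat variety `X^{2k+1}ₘ` (`β_last + γ_last = 0`), both
Ran-reachable from ALGEBRAIC Hodge characters, then `claim(α)`: the accidental duality
`V[β] ≅ V[-γ]` of two level-one pieces of coniveau `k` lifts to a `(1,1)`-class on a product of
two curves/Albanese varieties (Lefschetz), pushed forward along Gysin maps and Shioda's `f`. -/
def OddGluing : Prop :=
  ∀ (m k : ℕ) [NeZero m] (β γ : Fin (2 * k + 3) → ZMod m)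
    (α : Fin (2 * (2 * k + 1) + 2) → ZMod m),
    FermatCharacter.IsHodge α →
    (∀ i, β i ≠ 0) → (∀ i, γ i ≠ 0) →
    β (Fin.last _) + γ (Fin.last _) = 0 →
    univ.val.map α + {β (Fin.last _), γ (Fin.last _)} = univ.val.map β + univ.val.map γ →
    RanReachable β → RanReachable γ →
    (∀ (δ : Fin (2 * k + 2) → ZMod m), FermatCharacter.IsHodge δ → FermatCharacter.Claim m k δ) →
      FermatCharacter.Claim m (2 * k + 1) α

/-! ## Card C — primitive gaps descend along the degree -/

/-- Pull-back of multisets along `X^n_{m} → X^n_{d}`, `[x] ↦ [x^{m/d}]` (`d ∣ m`): a character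
`a ↦ (m/d)·a`. -/
noncomputable def pullbackMultiset (m d : ℕ) (s : Multiset (ZMod d)) : Multiset (ZMod m) :=
  s.map (fun a => ((m / d : ℕ) : ZMod m) * (a.val : ZMod m))

/-- **Primitive-gap descent** (Card C, first lemma, arithmetic form): the Hodge lattice of degree
`m` is generated over `ℤ` by the known-algebraic multisets together with the pull-backs of Hodge
multisets of the divisor levels `d ∣ m` having at most two distinct prime factors. Census: at
`m = 70` the unique gap coset is the pull-back of the `m = 35` gap `{1,2,16,17,21,22,30,31}`. -/
def PrimitiveGapDescent (m : ℕ) [NeZero m] : Prop :=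
  ∀ s : Multiset (ZMod m), FermatCharacter.IsHodgeMultiset s →
    toZVec s ∈ Submodule.span ℤ (knownGenerators m ∪
      {v | ∃ (d : ℕ) (_ : NeZero d) (u : Multiset (ZMod d)), d ∣ m ∧ d.primeFactors.card ≤ 2 ∧
            FermatCharacter.IsHodgeMultiset u ∧ v = toZVec (pullbackMultiset m d u)})

/-- Pull-backs of algebraic eigenlines are algebraic (geometric half of Card C): if `claim` holds
for a Hodge character `u` of `X^{2r}_d` then it holds for its pull-back character on `X^{2r}_m`,
`d ∣ m`. -/
def ClaimPullback : Prop :=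
  ∀ (m d r : ℕ) [NeZero m] [NeZero d] (u : Fin (2 * r + 2) → ZMod d), d ∣ m →
    FermatCharacter.IsHodge u → FermatCharacter.Claim d r u →
      FermatCharacter.Claim m r (fun i => ((m / d : ℕ) : ZMod m) * ((u i).val : ZMod m))

/-- Push-forward half (the "killing" direction of Card C): if the pulled-back character `k·α` is
algebraic on `X^{2r}_m` (`m = k d`), then `α` is algebraic on `X^{2r}_d`, because
`π_* π^* = deg π` for the finite map `[x] ↦ [x^k]`. -/
def ClaimPushforward : Prop :=
  ∀ (m d r : ℕ) [NeZero m] [NeZero d] (u : Fin (2 * r + 2) → ZMod d), d ∣ m →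
    FermatCharacter.IsHodge u →
    FermatCharacter.Claim m r (fun i => ((m / d : ℕ) : ZMod m) * ((u i).val : ZMod m)) →
      FermatCharacter.Claim d r u

end Summit.HodgeConjecture.HodgeConjecture.Cruxes.HodgeFermatVarieties.IdeatorOne
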